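import Summits.CriticalPhenomena.PercolationContinuityZ3.Theorems.PercNearOneGluingNoHeavyLowerTailSahiOneStepFibreThresholdAll
import HarnessLib

/-!
# One-step scheme, `(2′)` half: the PIVOT IDENTITY for `n` along a COUNTED coordinate and the reduction of
# "Kahn C5 for every threshold slot" to a single one-coordinate STEP inequality

Support file (prover prim-ineq-prove-3 gen 19; `--supports stmt-CriticalPhenomena-4575`; memo
`run/shared/lean/prim/prim-ineq-prove-3/FINDING-G19-NA-SHRINK-MONOP.md` §3).  No definitions, no named facts, no sorries, no `native_decide`.

Setting (`…SahiOneStepCone`): `μ = prodBernoulli p`, first slot `H`, `n = osN p H (ind A) (ind B)`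
(`n ≥ 0 ⟺ Cov(A,B) ≥ μ(Hᶜ)·Cov(A,B ∣ Hᶜ)`).  For a coordinate `e` write `X¹ = {ω | insert e ω ∈ X}`, `X⁰ = {ω | ω ∖ {e} ∈ X}`.
* `osN_ind_ind_pivot_eq` — for ARBITRARY `H, A, B, e`:
  `n(H;A,B) = p_e²·n(H¹;A¹,B¹) + q_e²·n(H⁰;A⁰,B⁰) + p_e q_e·(p_e·M₂ + q_e·M₁)` with the explicit "step forms"
  `M₂ = (μA⁰−μ(H⁰A⁰))(μB¹−μ(H¹B¹)) + (μA¹−μ(H¹A¹))(μB⁰−μ(H⁰B⁰)) + (1−μH⁰)μ(H¹A¹B¹) + (1−μH¹)μ(H⁰A⁰B⁰) − (μH¹−μH⁰)μA¹μB¹ − (1−μH¹)(μA¹μB⁰+μA⁰μB¹)`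
  and `M₁ = M₂ + (μH¹−μH⁰)(μA¹−μA⁰)(μB¹−μB⁰)` (the degree-3 Bernstein expansion of `n` in `p_e`: `3C₁ = n⁰ + M₁`, `3C₂ = n¹ + M₂`);
* `osN_ind_ind_nonneg_of_step` — hence `n(H¹;A¹,B¹) ≥ 0`, `n(H⁰;A⁰,B⁰) ≥ 0`, `M₂ ≥ 0` and monotone sections give `n(H;A,B) ≥ 0`;
* `section_insert_threshold`, `section_sdiff_threshold` — the sections of the threshold slot `{ω | t+1 ≤ #(insert e F ∩ ω)}` (`e ∉ F`) are the
  threshold slots `t` and `t+1` of `F`;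
* **`osN_threshold_nonneg_of_step`** — if the step form `M₂` is nonnegative for every threshold slot, every counted coordinate and every pair of
  increasing events determined by the block, then `n ≥ 0` for EVERY threshold slot and every such pair (induction on `|F|`);
* **`sahiE3_threshold_nonneg_of_step`** — with `osMp_threshold_nonneg_all` (gen 17, the `(3′)` half for all thresholds) and the one-step scheme:
  the step hypothesis alone implies `E₃({ω | t ≤ #(F∩ω)}, A, B) ≥ 0` for every `F`, `t` and ALL increasing `A, B ⊆ 2^ι` (Kahn C5 / Sahi C₃ for every
  threshold first slot).  The step hypothesis (`M₂ ≥ 0`, equivalently the odds-coefficient inequality `n₁ ≥ n₀` in one variable) is verified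
  exactly for all pairs of nested up-set pairs on ≤ 4 coordinates and is the `p_e → 1` end of "`n/p_e` is non-increasing in `p_e`" (memo §3).
-/

noncomputable section

namespace Summit.CriticalPhenomena.PercolationContinuityZ3.Theorems

namespace SahiOneStep

open MeasureTheory
open Literature.Probability.Percolation (DeterminedBy determinedBy_iff)
open Literature.Probability.LatticeModels (prodBernoulli sahiE3)
open Literature.Probability.Percolation.DecisionTree (ind)
open SahiE3Sections (determinedBy_section_insert determinedBy_section_sdiff)
open scoped Classical

variable {ι : Type*} [Fintype ι]

/-! ## The pivot identity for `n` along an arbitrary coordinate -/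

/-- **PIVOT IDENTITY for `n` along an arbitrary coordinate `e`** (degree-3 Bernstein expansion in `p_e`):
`n(H;A,B) = p²·n(H¹;A¹,B¹) + q²·n(H⁰;A⁰,B⁰) + pq·(p·M₂ + q·M₁)`. [this work] -/
theorem osN_ind_ind_pivot_eq (p : ι → unitInterval) (H A B : Set (Set ι)) (e : ι) :
    osN p H (ind A) (ind B) =
      (p e : ℝ) ^ 2 * osN p {ω : Set ι | insert e ω ∈ H} (ind {ω : Set ι | insert e ω ∈ A}) (ind {ω : Set ι | insert e ω ∈ B})
        + (1 - p e) ^ 2 * osN p {ω : Set ι | ω \ {e} ∈ H} (ind {ω : Set ι | ω \ {e} ∈ A}) (ind {ω : Set ι | ω \ {e} ∈ B})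
        + (p e : ℝ) * (1 - p e) *
          ((p e : ℝ) *
              (((prodBernoulli p).real {ω : Set ι | ω \ {e} ∈ A} - (prodBernoulli p).real ({ω : Set ι | ω \ {e} ∈ H} ∩ {ω : Set ι | ω \ {e} ∈ A})) *
                  ((prodBernoulli p).real {ω : Set ι | insert e ω ∈ B} - (prodBernoulli p).real ({ω : Set ι | insert e ω ∈ H} ∩ {ω : Set ι | insert e ω ∈ B}))
                + ((prodBernoulli p).real {ω : Set ι | insert e ω ∈ A} - (prodBernoulli p).real ({ω : Set ι | insert e ω ∈ H} ∩ {ω : Set ι | insert e ω ∈ A})) *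
                  ((prodBernoulli p).real {ω : Set ι | ω \ {e} ∈ B} - (prodBernoulli p).real ({ω : Set ι | ω \ {e} ∈ H} ∩ {ω : Set ι | ω \ {e} ∈ B}))
                + (1 - (prodBernoulli p).real {ω : Set ι | ω \ {e} ∈ H}) *
                  (prodBernoulli p).real ({ω : Set ι | insert e ω ∈ H} ∩ {ω : Set ι | insert e ω ∈ A} ∩ {ω : Set ι | insert e ω ∈ B})
                + (1 - (prodBernoulli p).real {ω : Set ι | insert e ω ∈ H}) *
                  (prodBernoulli p).real ({ω : Set ι | ω \ {e} ∈ H} ∩ {ω : Set ι | ω \ {e} ∈ A} ∩ {ω : Set ι | ω \ {e} ∈ B})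
                - ((prodBernoulli p).real {ω : Set ι | insert e ω ∈ H} - (prodBernoulli p).real {ω : Set ι | ω \ {e} ∈ H}) *
                  (prodBernoulli p).real {ω : Set ι | insert e ω ∈ A} * (prodBernoulli p).real {ω : Set ι | insert e ω ∈ B}
                - (1 - (prodBernoulli p).real {ω : Set ι | insert e ω ∈ H}) *
                  ((prodBernoulli p).real {ω : Set ι | insert e ω ∈ A} * (prodBernoulli p).real {ω : Set ι | ω \ {e} ∈ B}
                    + (prodBernoulli p).real {ω : Set ι | ω \ {e} ∈ A} * (prodBernoulli p).real {ω : Set ι | insert e ω ∈ B}))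
            + (1 - p e) *
              (((prodBernoulli p).real {ω : Set ι | ω \ {e} ∈ A} - (prodBernoulli p).real ({ω : Set ι | ω \ {e} ∈ H} ∩ {ω : Set ι | ω \ {e} ∈ A})) *
                  ((prodBernoulli p).real {ω : Set ι | insert e ω ∈ B} - (prodBernoulli p).real ({ω : Set ι | insert e ω ∈ H} ∩ {ω : Set ι | insert e ω ∈ B}))
                + ((prodBernoulli p).real {ω : Set ι | insert e ω ∈ A} - (prodBernoulli p).real ({ω : Set ι | insert e ω ∈ H} ∩ {ω : Set ι | insert e ω ∈ A})) *
                  ((prodBernoulli p).real {ω : Set ι | ω \ {e} ∈ B} - (prodBernoulli p).real ({ω : Set ι | ω \ {e} ∈ H} ∩ {ω : Set ι | ω \ {e} ∈ B}))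
                + (1 - (prodBernoulli p).real {ω : Set ι | ω \ {e} ∈ H}) *
                  (prodBernoulli p).real ({ω : Set ι | insert e ω ∈ H} ∩ {ω : Set ι | insert e ω ∈ A} ∩ {ω : Set ι | insert e ω ∈ B})
                + (1 - (prodBernoulli p).real {ω : Set ι | insert e ω ∈ H}) *
                  (prodBernoulli p).real ({ω : Set ι | ω \ {e} ∈ H} ∩ {ω : Set ι | ω \ {e} ∈ A} ∩ {ω : Set ι | ω \ {e} ∈ B})
                - ((prodBernoulli p).real {ω : Set ι | insert e ω ∈ H} - (prodBernoulli p).real {ω : Set ι | ω \ {e} ∈ H}) *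
                  (prodBernoulli p).real {ω : Set ι | insert e ω ∈ A} * (prodBernoulli p).real {ω : Set ι | insert e ω ∈ B}
                - (1 - (prodBernoulli p).real {ω : Set ι | insert e ω ∈ H}) *
                  ((prodBernoulli p).real {ω : Set ι | insert e ω ∈ A} * (prodBernoulli p).real {ω : Set ι | ω \ {e} ∈ B}
                    + (prodBernoulli p).real {ω : Set ι | ω \ {e} ∈ A} * (prodBernoulli p).real {ω : Set ι | insert e ω ∈ B})
                + ((prodBernoulli p).real {ω : Set ι | insert e ω ∈ H} - (prodBernoulli p).real {ω : Set ι | ω \ {e} ∈ H}) *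
                  ((prodBernoulli p).real {ω : Set ι | insert e ω ∈ A} - (prodBernoulli p).real {ω : Set ι | ω \ {e} ∈ A}) *
                  ((prodBernoulli p).real {ω : Set ι | insert e ω ∈ B} - (prodBernoulli p).real {ω : Set ι | ω \ {e} ∈ B}))) := by
  have eH := real_split p e H
  have eA := real_split p e A
  have eB := real_split p e B
  have eHA : (prodBernoulli p).real (H ∩ A) =
      (p e : ℝ) * (prodBernoulli p).real ({ω : Set ι | insert e ω ∈ H} ∩ {ω : Set ι | insert e ω ∈ A}) +
        (1 - p e) * (prodBernoulli p).real ({ω : Set ι | ω \ {e} ∈ H} ∩ {ω : Set ι | ω \ {e} ∈ A}) := by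
    rw [real_split p e (H ∩ A), section_insert_inter, section_sdiff_inter]
  have eHB : (prodBernoulli p).real (H ∩ B) =
      (p e : ℝ) * (prodBernoulli p).real ({ω : Set ι | insert e ω ∈ H} ∩ {ω : Set ι | insert e ω ∈ B}) +
        (1 - p e) * (prodBernoulli p).real ({ω : Set ι | ω \ {e} ∈ H} ∩ {ω : Set ι | ω \ {e} ∈ B}) := by
    rw [real_split p e (H ∩ B), section_insert_inter, section_sdiff_inter]
  have eHAB : (prodBernoulli p).real (H ∩ A ∩ B) =
      (p e : ℝ) * (prodBernoulli p).real ({ω : Set ι | insert e ω ∈ H} ∩ {ω : Set ι | insert e ω ∈ A} ∩ {ω : Set ι | insert e ω ∈ B}) +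
        (1 - p e) * (prodBernoulli p).real ({ω : Set ι | ω \ {e} ∈ H} ∩ {ω : Set ι | ω \ {e} ∈ A} ∩ {ω : Set ι | ω \ {e} ∈ B}) := by
    rw [real_split p e (H ∩ A ∩ B), section_insert_inter, section_sdiff_inter, section_insert_inter, section_sdiff_inter]
  rw [osN_ind_ind, osN_ind_ind, osN_ind_ind, eH, eA, eB, eHA, eHB, eHAB]
  ring

/-- **The inductive step for `(2′)`**: if `n ≥ 0` for both section triples at `e`, the step form `M₂ ≥ 0`, and the sections are monotone
(`μH⁰ ≤ μH¹`, `μA⁰ ≤ μA¹`, `μB⁰ ≤ μB¹`, automatic for increasing `H, A, B`), then `n(H;A,B) ≥ 0`. [this work] -/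
theorem osN_ind_ind_nonneg_of_step (p : ι → unitInterval) (H A B : Set (Set ι)) (e : ι)
    (h1 : 0 ≤ osN p {ω : Set ι | insert e ω ∈ H} (ind {ω : Set ι | insert e ω ∈ A}) (ind {ω : Set ι | insert e ω ∈ B}))
    (h0 : 0 ≤ osN p {ω : Set ι | ω \ {e} ∈ H} (ind {ω : Set ι | ω \ {e} ∈ A}) (ind {ω : Set ι | ω \ {e} ∈ B}))
    (hM2 : 0 ≤
      ((prodBernoulli p).real {ω : Set ι | ω \ {e} ∈ A} - (prodBernoulli p).real ({ω : Set ι | ω \ {e} ∈ H} ∩ {ω : Set ι | ω \ {e} ∈ A})) *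
          ((prodBernoulli p).real {ω : Set ι | insert e ω ∈ B} - (prodBernoulli p).real ({ω : Set ι | insert e ω ∈ H} ∩ {ω : Set ι | insert e ω ∈ B}))
        + ((prodBernoulli p).real {ω : Set ι | insert e ω ∈ A} - (prodBernoulli p).real ({ω : Set ι | insert e ω ∈ H} ∩ {ω : Set ι | insert e ω ∈ A})) *
          ((prodBernoulli p).real {ω : Set ι | ω \ {e} ∈ B} - (prodBernoulli p).real ({ω : Set ι | ω \ {e} ∈ H} ∩ {ω : Set ι | ω \ {e} ∈ B}))
        + (1 - (prodBernoulli p).real {ω : Set ι | ω \ {e} ∈ H}) *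
          (prodBernoulli p).real ({ω : Set ι | insert e ω ∈ H} ∩ {ω : Set ι | insert e ω ∈ A} ∩ {ω : Set ι | insert e ω ∈ B})
        + (1 - (prodBernoulli p).real {ω : Set ι | insert e ω ∈ H}) *
          (prodBernoulli p).real ({ω : Set ι | ω \ {e} ∈ H} ∩ {ω : Set ι | ω \ {e} ∈ A} ∩ {ω : Set ι | ω \ {e} ∈ B})
        - ((prodBernoulli p).real {ω : Set ι | insert e ω ∈ H} - (prodBernoulli p).real {ω : Set ι | ω \ {e} ∈ H}) *
          (prodBernoulli p).real {ω : Set ι | insert e ω ∈ A} * (prodBernoulli p).real {ω : Set ι | insert e ω ∈ B}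
        - (1 - (prodBernoulli p).real {ω : Set ι | insert e ω ∈ H}) *
          ((prodBernoulli p).real {ω : Set ι | insert e ω ∈ A} * (prodBernoulli p).real {ω : Set ι | ω \ {e} ∈ B}
            + (prodBernoulli p).real {ω : Set ι | ω \ {e} ∈ A} * (prodBernoulli p).real {ω : Set ι | insert e ω ∈ B}))
    (hH : (prodBernoulli p).real {ω : Set ι | ω \ {e} ∈ H} ≤ (prodBernoulli p).real {ω : Set ι | insert e ω ∈ H})
    (hA : (prodBernoulli p).real {ω : Set ι | ω \ {e} ∈ A} ≤ (prodBernoulli p).real {ω : Set ι | insert e ω ∈ A})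
    (hB : (prodBernoulli p).real {ω : Set ι | ω \ {e} ∈ B} ≤ (prodBernoulli p).real {ω : Set ι | insert e ω ∈ B}) :
    0 ≤ osN p H (ind A) (ind B) := by
  rw [osN_ind_ind_pivot_eq p H A B e]
  have hp0 : 0 ≤ (p e : ℝ) := (p e).2.1
  have hq0 : 0 ≤ 1 - (p e : ℝ) := sub_nonneg.2 (p e).2.2
  have hX : 0 ≤ ((prodBernoulli p).real {ω : Set ι | insert e ω ∈ H} - (prodBernoulli p).real {ω : Set ι | ω \ {e} ∈ H}) *
      ((prodBernoulli p).real {ω : Set ι | insert e ω ∈ A} - (prodBernoulli p).real {ω : Set ι | ω \ {e} ∈ A}) *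
      ((prodBernoulli p).real {ω : Set ι | insert e ω ∈ B} - (prodBernoulli p).real {ω : Set ι | ω \ {e} ∈ B}) :=
    mul_nonneg (mul_nonneg (sub_nonneg.2 hH) (sub_nonneg.2 hA)) (sub_nonneg.2 hB)
  have t1 := mul_nonneg (pow_nonneg hp0 2) h1
  have t2 := mul_nonneg (pow_nonneg hq0 2) h0
  have t3 := mul_nonneg hp0 hM2
  have t4 := mul_nonneg hq0 (add_nonneg hM2 hX)
  have t5 := mul_nonneg (mul_nonneg hp0 hq0) (add_nonneg t3 t4)
  nlinarith [t1, t2, t5]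

/-! ## Sections of a threshold slot -/

omit [Fintype ι] in
/-- Counting inside `insert e F` for `ω` containing `e`: `#(insert e F ∩ insert e ω) = #(F ∩ ω) + 1` (`e ∉ F`). [folklore] -/
theorem card_filter_insert_insert {F : Finset ι} {e : ι} (he : e ∉ F) (ω : Set ι) :
    ((insert e F).filter (· ∈ insert e ω)).card = (F.filter (· ∈ ω)).card + 1 := by
  rw [Finset.filter_insert, if_pos (Set.mem_insert e ω)]
  have hF : (F.filter (· ∈ insert e ω)) = F.filter (· ∈ ω) := by
    ext i
    simp only [Finset.mem_filter, Set.mem_insert_iff, and_congr_right_iff]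
    intro hi
    constructor
    · rintro (rfl | h)
      · exact absurd hi he
      · exact h
    · exact fun h => Or.inr h
  rw [hF, Finset.card_insert_of_notMem]
  exact fun h => he (Finset.mem_filter.1 h).1

omit [Fintype ι] in
/-- Counting inside `insert e F` for `ω` avoiding `e`: `#(insert e F ∩ (ω ∖ {e})) = #(F ∩ ω)` (`e ∉ F`). [folklore] -/
theorem card_filter_insert_sdiff {F : Finset ι} {e : ι} (he : e ∉ F) (ω : Set ι) :
    ((insert e F).filter (· ∈ ω \ {e})).card = (F.filter (· ∈ ω)).card := by
  rw [Finset.filter_insert, if_neg (fun h : e ∈ ω \ {e} => h.2 rfl)]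
  congr 1
  ext i
  simp only [Finset.mem_filter, Set.mem_sdiff_singleton, and_congr_right_iff]
  intro hi
  exact ⟨fun h => h.1, fun h => ⟨h, fun hie => he (hie ▸ hi)⟩⟩

omit [Fintype ι] in
/-- Inner section of the threshold slot `t+1` on `insert e F` = threshold slot `t` on `F` (`e ∉ F`). [folklore] -/
theorem section_insert_threshold {F : Finset ι} {e : ι} (he : e ∉ F) (t : ℕ) :
    {ω : Set ι | insert e ω ∈ {ω : Set ι | t + 1 ≤ ((insert e F).filter (· ∈ ω)).card}} =
      {ω : Set ι | t ≤ (F.filter (· ∈ ω)).card} := by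
  ext ω
  simp only [Set.mem_setOf_eq]
  -- normalise the (classical) decidability instance hidden in the threshold slot before rewriting
  rw [Finset.filter_congr_decidable (insert e F) (· ∈ insert e ω) _, card_filter_insert_insert he ω]
  exact Nat.add_le_add_iff_right

omit [Fintype ι] in
/-- Outer section of the threshold slot `t+1` on `insert e F` = threshold slot `t+1` on `F` (`e ∉ F`). [folklore] -/
theorem section_sdiff_threshold {F : Finset ι} {e : ι} (he : e ∉ F) (t : ℕ) :
    {ω : Set ι | ω \ {e} ∈ {ω : Set ι | t + 1 ≤ ((insert e F).filter (· ∈ ω)).card}} =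
      {ω : Set ι | t + 1 ≤ (F.filter (· ∈ ω)).card} := by
  ext ω
  simp only [Set.mem_setOf_eq]
  rw [Finset.filter_congr_decidable (insert e F) (· ∈ ω \ {e}) _, card_filter_insert_sdiff he ω]

omit [Fintype ι] in
/-- Threshold slots are nested: slot `t+1` is contained in slot `t`. [folklore] -/
theorem threshold_succ_subset (F : Finset ι) (t : ℕ) :
    {ω : Set ι | t + 1 ≤ (F.filter (· ∈ ω)).card} ⊆ {ω : Set ι | t ≤ (F.filter (· ∈ ω)).card} :=
  fun _ h => le_trans (Nat.le_succ t) h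

/-- `n` vanishes when the first slot is the whole space. [this work] -/
theorem osN_ind_ind_univ (p : ι → unitInterval) (A B : Set (Set ι)) :
    osN p (Set.univ : Set (Set ι)) (ind A) (ind B) = 0 := by
  rw [osN_ind_ind, Set.univ_inter, Set.univ_inter]
  have h1 : (prodBernoulli p).real (Set.univ : Set (Set ι)) = 1 := by
    rw [measureReal_def, measure_univ, ENNReal.toReal_one]
  rw [h1]; ring

/-- `n` vanishes when the first slot is empty. [this work] -/
theorem osN_ind_ind_empty (p : ι → unitInterval) (A B : Set (Set ι)) :
    osN p (∅ : Set (Set ι)) (ind A) (ind B) = 0 := by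
  rw [osN_ind_ind]
  simp only [Set.empty_inter, measureReal_empty]
  ring

omit [Fintype ι] in
/-- The threshold slot `0` is everything. [folklore] -/
theorem threshold_zero (F : Finset ι) : {ω : Set ι | 0 ≤ (F.filter (· ∈ ω)).card} = Set.univ :=
  Set.eq_univ_of_forall fun _ => Nat.zero_le _

omit [Fintype ι] in
/-- On the empty block a positive threshold slot is empty. [folklore] -/
theorem threshold_empty_succ (t : ℕ) : {ω : Set ι | t + 1 ≤ ((∅ : Finset ι).filter (· ∈ ω)).card} = ∅ := by
  ext ω
  simp only [Finset.filter_empty, Finset.card_empty, Set.mem_setOf_eq, Set.mem_empty_iff_false, iff_false, not_le]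
  exact Nat.succ_pos t

/-! ## The reduction: the one-coordinate step inequality implies `(2′)` for every threshold slot -/

/-- **REDUCTION OF `(2′)` FOR ALL THRESHOLD SLOTS TO THE ONE-COORDINATE STEP INEQUALITY.**  Suppose that for every block `F`, every `e ∉ F`,
every `t` and all increasing `A, B` determined by `insert e F`, the step form `M₂` of `osN_ind_ind_pivot_eq` for the slot
`H = {ω | t+1 ≤ #(insert e F ∩ ω)}` at the coordinate `e` is nonnegative.  Then `n(H;A,B) ≥ 0` for EVERY threshold slot `H = {ω | t ≤ #(F ∩ ω)}` and
all increasing `A, B` determined by `F`. [this work] -/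
theorem osN_threshold_nonneg_of_step (p : ι → unitInterval)
    (hstep : ∀ (F : Finset ι) (e : ι), e ∉ F → ∀ (t : ℕ) (A B : Set (Set ι)), IsUpperSet A → IsUpperSet B →
      DeterminedBy A (↑(insert e F) : Set ι) → DeterminedBy B (↑(insert e F) : Set ι) →
      let H : Set (Set ι) := {ω : Set ι | t + 1 ≤ ((insert e F).filter (· ∈ ω)).card}
      0 ≤
      ((prodBernoulli p).real {ω : Set ι | ω \ {e} ∈ A} - (prodBernoulli p).real ({ω : Set ι | ω \ {e} ∈ H} ∩ {ω : Set ι | ω \ {e} ∈ A})) *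
          ((prodBernoulli p).real {ω : Set ι | insert e ω ∈ B} - (prodBernoulli p).real ({ω : Set ι | insert e ω ∈ H} ∩ {ω : Set ι | insert e ω ∈ B}))
        + ((prodBernoulli p).real {ω : Set ι | insert e ω ∈ A} - (prodBernoulli p).real ({ω : Set ι | insert e ω ∈ H} ∩ {ω : Set ι | insert e ω ∈ A})) *
          ((prodBernoulli p).real {ω : Set ι | ω \ {e} ∈ B} - (prodBernoulli p).real ({ω : Set ι | ω \ {e} ∈ H} ∩ {ω : Set ι | ω \ {e} ∈ B}))
        + (1 - (prodBernoulli p).real {ω : Set ι | ω \ {e} ∈ H}) *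
          (prodBernoulli p).real ({ω : Set ι | insert e ω ∈ H} ∩ {ω : Set ι | insert e ω ∈ A} ∩ {ω : Set ι | insert e ω ∈ B})
        + (1 - (prodBernoulli p).real {ω : Set ι | insert e ω ∈ H}) *
          (prodBernoulli p).real ({ω : Set ι | ω \ {e} ∈ H} ∩ {ω : Set ι | ω \ {e} ∈ A} ∩ {ω : Set ι | ω \ {e} ∈ B})
        - ((prodBernoulli p).real {ω : Set ι | insert e ω ∈ H} - (prodBernoulli p).real {ω : Set ι | ω \ {e} ∈ H}) *
          (prodBernoulli p).real {ω : Set ι | insert e ω ∈ A} * (prodBernoulli p).real {ω : Set ι | insert e ω ∈ B}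
        - (1 - (prodBernoulli p).real {ω : Set ι | insert e ω ∈ H}) *
          ((prodBernoulli p).real {ω : Set ι | insert e ω ∈ A} * (prodBernoulli p).real {ω : Set ι | ω \ {e} ∈ B}
            + (prodBernoulli p).real {ω : Set ι | ω \ {e} ∈ A} * (prodBernoulli p).real {ω : Set ι | insert e ω ∈ B}))
    (F : Finset ι) (t : ℕ) {A B : Set (Set ι)} (hA : IsUpperSet A) (hB : IsUpperSet B)
    (hAF : DeterminedBy A (↑F : Set ι)) (hBF : DeterminedBy B (↑F : Set ι)) :
    0 ≤ osN p {ω : Set ι | t ≤ (F.filter (· ∈ ω)).card} (ind A) (ind B) := by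
  induction F using Finset.induction_on generalizing t A B with
  | empty =>
    cases t with
    | zero => rw [threshold_zero, osN_ind_ind_univ]
    | succ t => rw [threshold_empty_succ, osN_ind_ind_empty]
  | insert e F heF ih =>
    cases t with
    | zero => rw [threshold_zero, osN_ind_ind_univ]
    | succ t =>
      have hcoe : (↑(insert e F) : Set ι) \ {e} = ↑F := by
        ext i
        simp only [Set.mem_sdiff, Finset.coe_insert, Set.mem_insert_iff, Finset.mem_coe, Set.mem_singleton_iff]
        constructor
        · rintro ⟨h | h, hne⟩
          · exact absurd h hne
          · exact h
        · intro h
          exact ⟨Or.inr h, fun hie => heF (hie ▸ h)⟩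
      have hA1 : DeterminedBy {ω : Set ι | insert e ω ∈ A} (↑F : Set ι) := hcoe ▸ determinedBy_section_insert hAF e
      have hA0 : DeterminedBy {ω : Set ι | ω \ {e} ∈ A} (↑F : Set ι) := hcoe ▸ determinedBy_section_sdiff hAF e
      have hB1 : DeterminedBy {ω : Set ι | insert e ω ∈ B} (↑F : Set ι) := hcoe ▸ determinedBy_section_insert hBF e
      have hB0 : DeterminedBy {ω : Set ι | ω \ {e} ∈ B} (↑F : Set ι) := hcoe ▸ determinedBy_section_sdiff hBF e
      refine osN_ind_ind_nonneg_of_step p _ A B e ?_ ?_ (hstep F e heF t A B hA hB hAF hBF) ?_ ?_ ?_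
      · rw [section_insert_threshold heF]
        exact ih t (isUpperSet_section_insert hA e) (isUpperSet_section_insert hB e) hA1 hB1
      · rw [section_sdiff_threshold heF]
        exact ih (t + 1) (isUpperSet_section_sdiff hA e) (isUpperSet_section_sdiff hB e) hA0 hB0
      · rw [section_insert_threshold heF, section_sdiff_threshold heF]
        exact measureReal_mono (threshold_succ_subset F t)
      · exact measureReal_mono (section_sdiff_subset_section_insert hA e)
      · exact measureReal_mono (section_sdiff_subset_section_insert hB e)

/-- **KAHN C5 / SAHI C₃ FOR EVERY THRESHOLD FIRST SLOT, CONDITIONAL ONLY ON THE ONE-COORDINATE STEP INEQUALITY.**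
Under the step hypothesis of `osN_threshold_nonneg_of_step` (the `(2′)` side; the `(3′)` side is the unconditional
`osMp_threshold_nonneg_all`), `0 ≤ E₃({ω | t ≤ #(F ∩ ω)}, A, B)` for every `F`, `t` and ALL increasing `A, B ⊆ 2^ι`. [this work] -/
theorem sahiE3_threshold_nonneg_of_step (p : ι → unitInterval)
    (hstep : ∀ (F : Finset ι) (e : ι), e ∉ F → ∀ (t : ℕ) (A B : Set (Set ι)), IsUpperSet A → IsUpperSet B →
      DeterminedBy A (↑(insert e F) : Set ι) → DeterminedBy B (↑(insert e F) : Set ι) →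
      let H : Set (Set ι) := {ω : Set ι | t + 1 ≤ ((insert e F).filter (· ∈ ω)).card}
      0 ≤
      ((prodBernoulli p).real {ω : Set ι | ω \ {e} ∈ A} - (prodBernoulli p).real ({ω : Set ι | ω \ {e} ∈ H} ∩ {ω : Set ι | ω \ {e} ∈ A})) *
          ((prodBernoulli p).real {ω : Set ι | insert e ω ∈ B} - (prodBernoulli p).real ({ω : Set ι | insert e ω ∈ H} ∩ {ω : Set ι | insert e ω ∈ B}))
        + ((prodBernoulli p).real {ω : Set ι | insert e ω ∈ A} - (prodBernoulli p).real ({ω : Set ι | insert e ω ∈ H} ∩ {ω : Set ι | insert e ω ∈ A})) *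
          ((prodBernoulli p).real {ω : Set ι | ω \ {e} ∈ B} - (prodBernoulli p).real ({ω : Set ι | ω \ {e} ∈ H} ∩ {ω : Set ι | ω \ {e} ∈ B}))
        + (1 - (prodBernoulli p).real {ω : Set ι | ω \ {e} ∈ H}) *
          (prodBernoulli p).real ({ω : Set ι | insert e ω ∈ H} ∩ {ω : Set ι | insert e ω ∈ A} ∩ {ω : Set ι | insert e ω ∈ B})
        + (1 - (prodBernoulli p).real {ω : Set ι | insert e ω ∈ H}) *
          (prodBernoulli p).real ({ω : Set ι | ω \ {e} ∈ H} ∩ {ω : Set ι | ω \ {e} ∈ A} ∩ {ω : Set ι | ω \ {e} ∈ B})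
        - ((prodBernoulli p).real {ω : Set ι | insert e ω ∈ H} - (prodBernoulli p).real {ω : Set ι | ω \ {e} ∈ H}) *
          (prodBernoulli p).real {ω : Set ι | insert e ω ∈ A} * (prodBernoulli p).real {ω : Set ι | insert e ω ∈ B}
        - (1 - (prodBernoulli p).real {ω : Set ι | insert e ω ∈ H}) *
          ((prodBernoulli p).real {ω : Set ι | insert e ω ∈ A} * (prodBernoulli p).real {ω : Set ι | ω \ {e} ∈ B}
            + (prodBernoulli p).real {ω : Set ι | ω \ {e} ∈ A} * (prodBernoulli p).real {ω : Set ι | insert e ω ∈ B}))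
    (F : Finset ι) (t : ℕ) {A B : Set (Set ι)} (hA : IsUpperSet A) (hB : IsUpperSet B) :
    0 ≤ sahiE3 (prodBernoulli p) {ω : Set ι | t ≤ (F.filter (· ∈ ω)).card} A B :=
  sahiE3_nonneg_of_ind p (determinedBy_threshold F t)
    (fun _ _ hA' hB' hAF hBF => osMp_threshold_nonneg p F t hA' hB' hAF hBF)
    (fun _ _ hA' hB' hAF hBF => osN_threshold_nonneg_of_step p hstep F t hA' hB' hAF hBF) hA hB

end SahiOneStep

end Summit.CriticalPhenomena.PercolationContinuityZ3.Theorems
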